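import Summits.SmoothPoincare4.SmoothPoincare4.Theorems.ConvexBisectionAcyclicBisectionExistsDualHandleModelMap
import Mathlib.Analysis.SpecialFunctions.SmoothTransition
import Mathlib.Analysis.SpecialFunctions.Log.Deriv
import HarnessLib

/-!
# Dual handles, X-b: the `λ`-push profile of the model push of `X₁` (an exponential conjugate)
(brick (PUSH-b) of the sub-goal T3b step (ii) "push the prefix sub-handlebody `X₁` off the cocore
neighbourhood `N` of the suffix handles" of stub `stub_steinRealisation` (NF6), line
`modp-braid-orbits` r11, crux `ConvexBisection.AcyclicBisectionExists`, item
stmt-SmoothPoincare4-10508; wave 3, lead c5, worker Z3)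

Coordinates of the model `ℝ⁴ = ℝ²_λ × ℝ²_μ` around the `j`-th belt circle (`…DualHandleModelMap.lean`):
`P = ‖x_λ‖²`, `Q = ‖x_μ‖²`.  The model push `sh = Φ₂ ∘ Φ₁` (`…DualHandlePush.lean`) keeps the
torus directions; this file is the scalar part of `Φ₂`, the `λ`-push at fixed `Q`:
`P ↦ pushP κ P q` (`q = Q/δ`), the conjugate `E⁻¹ (E P + c)` of the translation by
`c = pushShift κ q ≥ 0` under `E P = exp (1/(κ²/2 - P))` on `P < κ²/2`, the identity on `P ≥ κ²/2`.
Written with `expNegInvGlue` it is ONE smooth formula on `ℝ²` (`contDiff_pushP`), automatically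
the identity where `c = 0` (`q ≥ 1/4`) or `P ≥ κ²/2` (no flatness estimates, no bound on
`sup |smoothTransition'|`), strictly increasing in `P` (`pushP_strictMono`), with the explicit
inverse `pullP` (translation by `-c`; `pullP_pushP`, `pushP_pullP`, `contDiffOn_pullP`), and `c` is
chosen so that the cone line `P = κ² q` goes to the swap-slab boundary `P = pFun κ q` of the cocore
neighbourhood (`pushP_base`).  Only structural facts about `Real.smoothTransition` are used.
Everything here is proved; no named facts.

## References
* J. Milnor, *Lectures on the h-cobordism theorem* (1965), §3 (dual handles). [MilnorHCobordism1965]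
* A. A. Kosinski, *Differential Manifolds* (1993), VI §6. [Kosinski1993]
-/

noncomputable section

-- the prescribed namespace `Summit.<P>.<Sub>.…` duplicates `SmoothPoincare4` (P = Sub)
set_option linter.dupNamespace false

open scoped Manifold ContDiff Topology

namespace Summit.SmoothPoincare4.SmoothPoincare4.Theorems.AcyclicBisectionExists.ModpBraidOrbits

open Set Function Metric
open Literature.Topology.FourManifolds Literature.Topology.FourManifolds.HandleAttachingMap

namespace PushModel

/-! ### §2 The `λ`-push `Φ₂`: an exponential conjugate of a translation -/

section Push

/-- `pFun κ q - κ² q = κ² (1 - ω₁ q)/8 ≥ 0`. [folklore] -/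
theorem sq_mul_le_pFun {κ : ℝ} (q : ℝ) : κ ^ 2 * q ≤ pFun κ q := by
  unfold pFun; nlinarith [(coreCut_mem q).2, sq_nonneg κ]

/-- `pFun κ q ≤ κ² (q + 1/8)`. [folklore] -/
theorem pFun_le {κ : ℝ} (q : ℝ) : pFun κ q ≤ κ ^ 2 * (q + 1 / 8) := by
  unfold pFun; nlinarith [(coreCut_mem q).1, sq_nonneg κ]

/-- `pFun κ q < κ²/2` for `q < 1/2` (`κ ≠ 0`). [folklore] -/
theorem pFun_lt_half {κ : ℝ} (hκ : 0 < κ) {q : ℝ} (hq : q < 1 / 2) : pFun κ q < κ ^ 2 / 2 := by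
  rcases lt_or_ge q (1 / 4) with h | h
  · have := pFun_le (κ := κ) q; nlinarith [sq_nonneg κ, pow_pos hκ 2]
  · rw [pFun_of_ge κ h]; nlinarith [pow_pos hκ 2]

/-- **The translation length `c(q) = E (pFun κ q) - E (κ² q)`** (`E P = exp (1/(κ²/2 - P))`) for
`q < 1/4`, and `0` for `q ≥ 1/4` (where `pFun κ q = κ² q`). [folklore] -/
def pushShift (κ q : ℝ) : ℝ :=
  if q < 1 / 4 then Real.exp (1 / (κ ^ 2 / 2 - pFun κ q)) - Real.exp (1 / (κ ^ 2 / 2 - κ ^ 2 * q)) else 0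

/-- `c(q) = 0` for `q ≥ 1/4`. [folklore] -/
theorem pushShift_of_ge {κ q : ℝ} (hq : 1 / 4 ≤ q) : pushShift κ q = 0 := by
  rw [pushShift, if_neg (not_lt.2 hq)]

/-- `c(q)` for `q < 1/4`. [folklore] -/
theorem pushShift_of_lt {κ q : ℝ} (hq : q < 1 / 4) :
    pushShift κ q = Real.exp (1 / (κ ^ 2 / 2 - pFun κ q)) - Real.exp (1 / (κ ^ 2 / 2 - κ ^ 2 * q)) := by
  rw [pushShift, if_pos hq]

/-- `c(q) ≥ 0`. [folklore] -/
theorem pushShift_nonneg {κ : ℝ} (hκ : 0 < κ) (q : ℝ) : 0 ≤ pushShift κ q := by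
  rcases lt_or_ge q (1 / 4) with h | h
  · rw [pushShift_of_lt h, sub_nonneg, Real.exp_le_exp]
    have h1 : pFun κ q < κ ^ 2 / 2 := pFun_lt_half hκ (by linarith)
    have h2 := sq_mul_le_pFun (κ := κ) q
    exact one_div_le_one_div_of_le (by linarith) (by linarith)
  · rw [pushShift_of_ge h]

/-- **`pushShift κ` is smooth** (the defining formula is smooth on `q < 1/2` and vanishes on
`[1/4, 1/2)`, so it glues with `0`). [folklore] -/
theorem contDiff_pushShift {κ : ℝ} (hκ : 0 < κ) : ContDiff ℝ ∞ (pushShift κ) := by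
  rw [contDiff_iff_contDiffAt]
  intro q
  by_cases hq : q < 1 / 2
  · have hev : pushShift κ =ᶠ[𝓝 q] fun t =>
        Real.exp (1 / (κ ^ 2 / 2 - pFun κ t)) - Real.exp (1 / (κ ^ 2 / 2 - κ ^ 2 * t)) := by
      filter_upwards [Iio_mem_nhds hq] with t ht
      rcases lt_or_ge t (1 / 4) with h | h
      · exact pushShift_of_lt h
      · rw [pushShift_of_ge h, pFun_of_ge κ h, sub_self]
    refine ContDiffAt.congr_of_eventuallyEq ?_ hev
    refine ((contDiffAt_const.div ?_ ?_).exp).sub ((contDiffAt_const.div ?_ ?_).exp)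
    · exact (contDiff_const.sub (contDiff_pFun κ)).contDiffAt
    · exact sub_ne_zero.2 (ne_of_gt (pFun_lt_half hκ hq))
    · exact (contDiff_const.sub (contDiff_const.mul contDiff_id)).contDiffAt
    · apply sub_ne_zero.2; apply ne_of_gt; nlinarith [pow_pos hκ 2]
  · have hlt : 1 / 4 < q := by linarith [not_lt.1 hq]
    have hev : pushShift κ =ᶠ[𝓝 q] fun _ => (0 : ℝ) := by
      filter_upwards [Ioi_mem_nhds hlt] with t ht
      exact pushShift_of_ge (le_of_lt ht)
    exact contDiffAt_const.congr_of_eventuallyEq hev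

/-- **The pushed `λ`-level `P' = pushP κ P q`**:
`κ²/2 - (κ²/2 - P)/(1 + (κ²/2 - P) log (1 + c(q) φ(κ²/2 - P)))`, `φ = expNegInvGlue` — one smooth
formula, equal to `κ²/2 - 1/log (exp (1/(κ²/2 - P)) + c(q))` for `P < κ²/2` and to `P` for
`P ≥ κ²/2`. [folklore] -/
def pushP (κ P q : ℝ) : ℝ :=
  κ ^ 2 / 2 - (κ ^ 2 / 2 - P) /
    (1 + (κ ^ 2 / 2 - P) * Real.log (1 + pushShift κ q * expNegInvGlue (κ ^ 2 / 2 - P)))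

/-- **The inverse `pullP κ P' q`** (translation by `-c(q)`): the same formula with `-c`. [folklore] -/
def pullP (κ P q : ℝ) : ℝ :=
  κ ^ 2 / 2 - (κ ^ 2 / 2 - P) /
    (1 + (κ ^ 2 / 2 - P) * Real.log (1 - pushShift κ q * expNegInvGlue (κ ^ 2 / 2 - P)))

/-- `pushP = id` on `P ≥ κ²/2`. [folklore] -/
theorem pushP_of_ge {κ P : ℝ} (q : ℝ) (hP : κ ^ 2 / 2 ≤ P) : pushP κ P q = P := by
  rw [pushP, expNegInvGlue.zero_of_nonpos (by linarith), mul_zero, add_zero, Real.log_one]; ring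

/-- `pullP = id` on `P ≥ κ²/2`. [folklore] -/
theorem pullP_of_ge {κ P : ℝ} (q : ℝ) (hP : κ ^ 2 / 2 ≤ P) : pullP κ P q = P := by
  rw [pullP, expNegInvGlue.zero_of_nonpos (by linarith), mul_zero, sub_zero, Real.log_one]; ring

/-- `pushP = id` where `c(q) = 0`, in particular for `q ≥ 1/4`. [folklore] -/
theorem pushP_of_shift_zero {κ q : ℝ} (P : ℝ) (h : pushShift κ q = 0) : pushP κ P q = P := by
  rw [pushP, h, zero_mul, add_zero, Real.log_one]; ring

/-- The conjugation identity behind `pushP`/`pullP`: for `A > 0` and `exp (1/A) + c > 1`,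
`A/(1 + A log (1 + c φ(A))) = 1/log (exp (1/A) + c)`. [folklore] -/
theorem conj_core {A c : ℝ} (hA : 0 < A) (h : 1 < Real.exp (1 / A) + c) :
    A / (1 + A * Real.log (1 + c * expNegInvGlue A)) = 1 / Real.log (Real.exp (1 / A) + c) := by
  set E := Real.exp (1 / A) with hE
  have hE0 : 0 < E := Real.exp_pos _
  have hφ : expNegInvGlue A = E⁻¹ := by
    rw [expNegInvGlue, if_neg (not_le.2 hA), hE, ← Real.exp_neg, one_div]
  have h1 : 1 + c * E⁻¹ = (E + c) / E := by field_simp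
  have hlog : Real.log (1 + c * E⁻¹) = Real.log (E + c) - 1 / A := by
    rw [h1, Real.log_div (by linarith) hE0.ne', hE, Real.log_exp]
  have hLpos : 0 < Real.log (E + c) := Real.log_pos h
  have h2 : 1 + A * (Real.log (E + c) - 1 / A) = A * Real.log (E + c) := by field_simp; ring
  rw [hφ, hlog, h2]
  field_simp

/-- **The conjugation formula**: for `P < κ²/2`,
`pushP κ P q = κ²/2 - 1/log (exp (1/(κ²/2 - P)) + c(q))`. [folklore] -/
theorem pushP_eq_of_lt {κ P q : ℝ} (hκ : 0 < κ) (hP : P < κ ^ 2 / 2) :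
    pushP κ P q = κ ^ 2 / 2 - 1 / Real.log (Real.exp (1 / (κ ^ 2 / 2 - P)) + pushShift κ q) := by
  have hA0 : 0 < κ ^ 2 / 2 - P := by linarith
  have hE1 : 1 < Real.exp (1 / (κ ^ 2 / 2 - P)) := Real.one_lt_exp_iff.2 (by positivity)
  rw [pushP, conj_core hA0 (by linarith [pushShift_nonneg hκ q])]

/-- The pull formula: for `P' < κ²/2` with `exp (1/(κ²/2 - P')) > 1 + c`,
`pullP κ P' q = κ²/2 - 1/log (exp (1/(κ²/2 - P')) - c(q))`. [folklore] -/
theorem pullP_eq_of_lt {κ P q : ℝ} (hP : P < κ ^ 2 / 2)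
    (hc : 1 + pushShift κ q < Real.exp (1 / (κ ^ 2 / 2 - P))) :
    pullP κ P q = κ ^ 2 / 2 - 1 / Real.log (Real.exp (1 / (κ ^ 2 / 2 - P)) - pushShift κ q) := by
  have hA0 : 0 < κ ^ 2 / 2 - P := by linarith
  rw [pullP, sub_eq_add_neg 1 (pushShift κ q * _), ← neg_mul, conj_core hA0 (by linarith), ← sub_eq_add_neg]

/-- For `P < κ²/2`: `P ≤ pushP κ P q < κ²/2`. [folklore] -/
theorem pushP_mem {κ P q : ℝ} (hκ : 0 < κ) (hP : P < κ ^ 2 / 2) :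
    P ≤ pushP κ P q ∧ pushP κ P q < κ ^ 2 / 2 := by
  rw [pushP_eq_of_lt hκ hP]
  have hA0 : 0 < κ ^ 2 / 2 - P := by linarith
  have hc := pushShift_nonneg hκ q
  have hE1 : 1 < Real.exp (1 / (κ ^ 2 / 2 - P)) := Real.one_lt_exp_iff.2 (by positivity)
  have hL : 1 / (κ ^ 2 / 2 - P) ≤ Real.log (Real.exp (1 / (κ ^ 2 / 2 - P)) + pushShift κ q) :=
    (Real.le_log_iff_exp_le (by linarith)).2 (by linarith)
  have hLpos : 0 < Real.log (Real.exp (1 / (κ ^ 2 / 2 - P)) + pushShift κ q) := Real.log_pos (by linarith)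
  constructor
  · have : 1 / Real.log (Real.exp (1 / (κ ^ 2 / 2 - P)) + pushShift κ q) ≤ κ ^ 2 / 2 - P := by
      rw [div_le_iff₀ hLpos]
      have := mul_le_mul_of_nonneg_left hL hA0.le
      rw [mul_one_div_cancel hA0.ne'] at this
      linarith
    linarith
  · have : 0 < 1 / Real.log (Real.exp (1 / (κ ^ 2 / 2 - P)) + pushShift κ q) := by positivity
    linarith

/-- `P ≤ pushP κ P q` everywhere. [folklore] -/
theorem le_pushP {κ : ℝ} (hκ : 0 < κ) (P q : ℝ) : P ≤ pushP κ P q := by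
  rcases lt_or_ge P (κ ^ 2 / 2) with h | h
  exacts [(pushP_mem hκ h).1, (pushP_of_ge q h).ge]

/-- **`pushP κ · q` is strictly increasing.** [folklore] -/
theorem pushP_strictMono {κ : ℝ} (hκ : 0 < κ) (q : ℝ) : StrictMono fun P => pushP κ P q := by
  intro P P' hPP'
  simp only
  rcases lt_or_ge P' (κ ^ 2 / 2) with h' | h'
  · have h : P < κ ^ 2 / 2 := lt_trans hPP' h'
    rw [pushP_eq_of_lt hκ h, pushP_eq_of_lt hκ h']
    have hc := pushShift_nonneg hκ q
    have hA : 0 < κ ^ 2 / 2 - P := by linarith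
    have hA' : 0 < κ ^ 2 / 2 - P' := by linarith
    have hEE : Real.exp (1 / (κ ^ 2 / 2 - P)) < Real.exp (1 / (κ ^ 2 / 2 - P')) :=
      Real.exp_lt_exp.2 (one_div_lt_one_div_of_lt hA' (by linarith))
    have hE1 : 1 < Real.exp (1 / (κ ^ 2 / 2 - P)) := Real.one_lt_exp_iff.2 (by positivity)
    have hL : 0 < Real.log (Real.exp (1 / (κ ^ 2 / 2 - P)) + pushShift κ q) := Real.log_pos (by linarith)
    have hLL : Real.log (Real.exp (1 / (κ ^ 2 / 2 - P)) + pushShift κ q) <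
        Real.log (Real.exp (1 / (κ ^ 2 / 2 - P')) + pushShift κ q) :=
      Real.log_lt_log (by linarith) (by linarith)
    have := one_div_lt_one_div_of_lt hL hLL
    linarith
  · rw [pushP_of_ge q h']
    rcases lt_or_ge P (κ ^ 2 / 2) with h | h
    · exact lt_of_lt_of_le (pushP_mem hκ h).2 h'
    · rw [pushP_of_ge q h]; exact hPP'

/-- **`Φ₂` moves the cone line onto the swap-slab boundary**: `pushP κ (κ² q) q = pFun κ q`.
[folklore] -/
theorem pushP_base {κ : ℝ} (hκ : 0 < κ) (q : ℝ) : pushP κ (κ ^ 2 * q) q = pFun κ q := by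
  rcases lt_or_ge q (1 / 4) with h | h
  · have hP : κ ^ 2 * q < κ ^ 2 / 2 := by nlinarith [pow_pos hκ 2]
    have h1 : pFun κ q < κ ^ 2 / 2 := pFun_lt_half hκ (by linarith)
    rw [pushP_eq_of_lt hκ hP, pushShift_of_lt h, add_sub_cancel, Real.log_exp, one_div_one_div]
    ring
  · rw [pushP_of_shift_zero _ (pushShift_of_ge h), pFun_of_ge κ h]

/-- **`pullP ∘ pushP = id`.** [folklore] -/
theorem pullP_pushP {κ : ℝ} (hκ : 0 < κ) (P q : ℝ) : pullP κ (pushP κ P q) q = P := by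
  rcases lt_or_ge P (κ ^ 2 / 2) with h | h
  · have hm := pushP_mem hκ h (q := q)
    have hc := pushShift_nonneg hκ q
    set E := Real.exp (1 / (κ ^ 2 / 2 - P)) with hE
    have hE1 : 1 < E := Real.one_lt_exp_iff.2 (by apply one_div_pos.2; linarith)
    have hL : 0 < Real.log (E + pushShift κ q) := Real.log_pos (by linarith)
    have hP' : pushP κ P q = κ ^ 2 / 2 - 1 / Real.log (E + pushShift κ q) := pushP_eq_of_lt hκ h
    have hA' : κ ^ 2 / 2 - pushP κ P q = 1 / Real.log (E + pushShift κ q) := by rw [hP']; ring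
    have hexp : Real.exp (1 / (κ ^ 2 / 2 - pushP κ P q)) = E + pushShift κ q := by
      rw [hA', one_div_one_div, Real.exp_log (by linarith)]
    rw [pullP_eq_of_lt hm.2 (by rw [hexp]; linarith), hexp, add_sub_cancel_right, hE, Real.log_exp,
      one_div_one_div]
    ring
  · rw [pushP_of_ge q h, pullP_of_ge q h]

/-- **`pushP ∘ pullP = id`** on `exp (1/(κ²/2 - P')) > 1 + c(q)` (automatic for `P' ≥ κ²/2`).
[folklore] -/
theorem pushP_pullP {κ : ℝ} (hκ : 0 < κ) {P q : ℝ}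
    (hc : P < κ ^ 2 / 2 → 1 + pushShift κ q < Real.exp (1 / (κ ^ 2 / 2 - P))) :
    pushP κ (pullP κ P q) q = P := by
  rcases lt_or_ge P (κ ^ 2 / 2) with h | h
  · have hc' := hc h
    have hc0 := pushShift_nonneg hκ q
    set E := Real.exp (1 / (κ ^ 2 / 2 - P)) with hE
    have hL : 0 < Real.log (E - pushShift κ q) := Real.log_pos (by linarith)
    have hP' : pullP κ P q = κ ^ 2 / 2 - 1 / Real.log (E - pushShift κ q) := pullP_eq_of_lt h hc'
    have hlt : pullP κ P q < κ ^ 2 / 2 := by rw [hP']; have := one_div_pos.2 hL; linarith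
    have hA' : κ ^ 2 / 2 - pullP κ P q = 1 / Real.log (E - pushShift κ q) := by rw [hP']; ring
    have hexp : Real.exp (1 / (κ ^ 2 / 2 - pullP κ P q)) = E - pushShift κ q := by
      rw [hA', one_div_one_div, Real.exp_log (by linarith)]
    rw [pushP_eq_of_lt hκ hlt, hexp, sub_add_cancel, hE, Real.log_exp, one_div_one_div]
    ring
  · rw [pullP_of_ge q h, pushP_of_ge q h]

/-- On the same set, `0 < pullP κ P' q ↔ exp (2/κ²) + c(q) < exp (1/(κ²/2 - P'))` (`P' < κ²/2`).
[folklore] -/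
theorem pullP_pos {κ : ℝ} (hκ : 0 < κ) {P q : ℝ} (hP : P < κ ^ 2 / 2)
    (hc : Real.exp (2 / κ ^ 2) + pushShift κ q < Real.exp (1 / (κ ^ 2 / 2 - P))) : 0 < pullP κ P q := by
  have hc0 := pushShift_nonneg hκ q
  have h1 : 1 < Real.exp (2 / κ ^ 2) := Real.one_lt_exp_iff.2 (by positivity)
  rw [pullP_eq_of_lt hP (by linarith)]
  set E := Real.exp (1 / (κ ^ 2 / 2 - P))
  have h2 : 2 / κ ^ 2 < Real.log (E - pushShift κ q) :=
    (Real.lt_log_iff_exp_lt (by linarith)).2 (by linarith)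
  have h3 : 0 < 2 / κ ^ 2 := by positivity
  have h4 : 1 / Real.log (E - pushShift κ q) < 1 / (2 / κ ^ 2) := one_div_lt_one_div_of_lt h3 h2
  rw [one_div_div] at h4
  linarith

/-- Conversely `pushP` of a positive level lands in that set:
`exp (2/κ²) + c(q) < exp (1/(κ²/2 - pushP κ P q))` for `0 < P < κ²/2`. [folklore] -/
theorem exp_lt_exp_pushP {κ : ℝ} (hκ : 0 < κ) {P q : ℝ} (hP0 : 0 < P) (hP : P < κ ^ 2 / 2) :
    Real.exp (2 / κ ^ 2) + pushShift κ q < Real.exp (1 / (κ ^ 2 / 2 - pushP κ P q)) := by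
  have hc := pushShift_nonneg hκ q
  set E := Real.exp (1 / (κ ^ 2 / 2 - P)) with hE
  have hE1 : 1 < E := Real.one_lt_exp_iff.2 (by apply one_div_pos.2; linarith)
  have hP' : κ ^ 2 / 2 - pushP κ P q = 1 / Real.log (E + pushShift κ q) := by
    rw [pushP_eq_of_lt hκ hP]; ring
  rw [hP', one_div_one_div, Real.exp_log (by linarith), hE]
  have : Real.exp (2 / κ ^ 2) < Real.exp (1 / (κ ^ 2 / 2 - P)) := by
    rw [Real.exp_lt_exp, lt_one_div (by positivity) (by linarith), one_div_div]
    linarith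
  linarith

/-- **`pushP κ` is jointly smooth on `ℝ²`.** [folklore] -/
theorem contDiff_pushP {κ : ℝ} (hκ : 0 < κ) : ContDiff ℝ ∞ fun z : ℝ × ℝ => pushP κ z.1 z.2 := by
  unfold pushP
  have hA : ContDiff ℝ ∞ fun z : ℝ × ℝ => κ ^ 2 / 2 - z.1 := contDiff_const.sub contDiff_fst
  have hin : ContDiff ℝ ∞ fun z : ℝ × ℝ => 1 + pushShift κ z.2 * expNegInvGlue (κ ^ 2 / 2 - z.1) :=
    contDiff_const.add (((contDiff_pushShift hκ).comp contDiff_snd).mul (expNegInvGlue.contDiff.comp hA))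
  have hin0 : ∀ z : ℝ × ℝ, 0 < 1 + pushShift κ z.2 * expNegInvGlue (κ ^ 2 / 2 - z.1) := fun z => by
    have := mul_nonneg (pushShift_nonneg hκ z.2) (expNegInvGlue.nonneg (κ ^ 2 / 2 - z.1))
    linarith
  have hlog : ContDiff ℝ ∞ fun z : ℝ × ℝ => Real.log (1 + pushShift κ z.2 * expNegInvGlue (κ ^ 2 / 2 - z.1)) :=
    hin.log fun z => (hin0 z).ne'
  have hden0 : ∀ z : ℝ × ℝ, (1 : ℝ) ≤ 1 + (κ ^ 2 / 2 - z.1) *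
      Real.log (1 + pushShift κ z.2 * expNegInvGlue (κ ^ 2 / 2 - z.1)) := fun z => by
    rcases le_or_gt (κ ^ 2 / 2 - z.1) 0 with h | h
    · rw [expNegInvGlue.zero_of_nonpos h, mul_zero, add_zero, Real.log_one, mul_zero, add_zero]
    · have : 0 ≤ Real.log (1 + pushShift κ z.2 * expNegInvGlue (κ ^ 2 / 2 - z.1)) :=
        Real.log_nonneg (by
          have := mul_nonneg (pushShift_nonneg hκ z.2) (expNegInvGlue.nonneg (κ ^ 2 / 2 - z.1))
          linarith)
      nlinarith
  exact contDiff_const.sub (hA.div (contDiff_const.add (hA.mul hlog)) fun z => by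
    have := hden0 z; positivity)

/-- The domain of the inverse: `φ(κ²/2 - P') · (exp (2/κ²) + c(q)) < 1`. [folklore] -/
def pullDom (κ : ℝ) : Set (ℝ × ℝ) :=
  {z | expNegInvGlue (κ ^ 2 / 2 - z.1) * (Real.exp (2 / κ ^ 2) + pushShift κ z.2) < 1}

/-- The domain of the inverse is open. [folklore] -/
theorem isOpen_pullDom {κ : ℝ} (hκ : 0 < κ) : IsOpen (pullDom κ) :=
  isOpen_lt (((expNegInvGlue.contDiff (n := 0)).continuous.comp (continuous_const.sub continuous_fst)).mul
    (continuous_const.add ((contDiff_pushShift hκ).continuous.comp continuous_snd))) continuous_const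

/-- On `pullDom`, below `κ²/2` the exponential bound `exp (2/κ²) + c < exp (1/(κ²/2 - P'))` holds.
[folklore] -/
theorem exp_lt_of_mem_pullDom {κ : ℝ} {z : ℝ × ℝ} (hz : z ∈ pullDom κ) (hP : z.1 < κ ^ 2 / 2) :
    Real.exp (2 / κ ^ 2) + pushShift κ z.2 < Real.exp (1 / (κ ^ 2 / 2 - z.1)) := by
  have hA : 0 < κ ^ 2 / 2 - z.1 := by linarith
  have hφ : expNegInvGlue (κ ^ 2 / 2 - z.1) = (Real.exp (1 / (κ ^ 2 / 2 - z.1)))⁻¹ := by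
    rw [expNegInvGlue, if_neg (not_le.2 hA), ← Real.exp_neg, one_div]
  have h := hz
  rw [pullDom, mem_setOf_eq, hφ, inv_mul_lt_iff₀ (Real.exp_pos _), mul_one] at h
  exact h

/-- Membership in `pullDom` from the exponential bound. [folklore] -/
theorem mem_pullDom_of_exp_lt {κ : ℝ} {z : ℝ × ℝ} (hP : z.1 < κ ^ 2 / 2)
    (h : Real.exp (2 / κ ^ 2) + pushShift κ z.2 < Real.exp (1 / (κ ^ 2 / 2 - z.1))) : z ∈ pullDom κ := by
  have hA : 0 < κ ^ 2 / 2 - z.1 := by linarith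
  have hφ : expNegInvGlue (κ ^ 2 / 2 - z.1) = (Real.exp (1 / (κ ^ 2 / 2 - z.1)))⁻¹ := by
    rw [expNegInvGlue, if_neg (not_le.2 hA), ← Real.exp_neg, one_div]
  rw [pullDom, mem_setOf_eq, hφ, inv_mul_lt_iff₀ (Real.exp_pos _), mul_one]
  exact h

/-- Levels `P' ≥ κ²/2` are in `pullDom`. [folklore] -/
theorem mem_pullDom_of_ge {κ : ℝ} {z : ℝ × ℝ} (hP : κ ^ 2 / 2 ≤ z.1) : z ∈ pullDom κ := by
  rw [pullDom, mem_setOf_eq, expNegInvGlue.zero_of_nonpos (by linarith), zero_mul]; exact one_pos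

/-- **`pullP κ` is jointly smooth on `pullDom κ`.** [folklore] -/
theorem contDiffOn_pullP {κ : ℝ} (hκ : 0 < κ) : ContDiffOn ℝ ∞ (fun z : ℝ × ℝ => pullP κ z.1 z.2) (pullDom κ) := by
  unfold pullP
  have hA : ContDiff ℝ ∞ fun z : ℝ × ℝ => κ ^ 2 / 2 - z.1 := contDiff_const.sub contDiff_fst
  have hin : ContDiff ℝ ∞ fun z : ℝ × ℝ => 1 - pushShift κ z.2 * expNegInvGlue (κ ^ 2 / 2 - z.1) :=
    contDiff_const.sub (((contDiff_pushShift hκ).comp contDiff_snd).mul (expNegInvGlue.contDiff.comp hA))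
  have h1 : (1 : ℝ) < Real.exp (2 / κ ^ 2) := Real.one_lt_exp_iff.2 (by positivity)
  -- on `pullDom`: `(1 + c) φ < 1`, hence `1 - c φ > φ ≥ 0` and the denominator exceeds `0`
  have key : ∀ z ∈ pullDom κ, expNegInvGlue (κ ^ 2 / 2 - z.1) <
      1 - pushShift κ z.2 * expNegInvGlue (κ ^ 2 / 2 - z.1) := fun z hz => by
    have h := hz
    rw [pullDom, mem_setOf_eq] at h
    nlinarith [expNegInvGlue.nonneg (κ ^ 2 / 2 - z.1), pushShift_nonneg hκ z.2]
  have hin0 : ∀ z ∈ pullDom κ, 0 < 1 - pushShift κ z.2 * expNegInvGlue (κ ^ 2 / 2 - z.1) := fun z hz =>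
    lt_of_le_of_lt (expNegInvGlue.nonneg _) (key z hz)
  have hlog : ContDiffOn ℝ ∞ (fun z : ℝ × ℝ => Real.log (1 - pushShift κ z.2 * expNegInvGlue (κ ^ 2 / 2 - z.1)))
      (pullDom κ) := hin.contDiffOn.log fun z hz => (hin0 z hz).ne'
  have hden0 : ∀ z ∈ pullDom κ, 0 < 1 + (κ ^ 2 / 2 - z.1) *
      Real.log (1 - pushShift κ z.2 * expNegInvGlue (κ ^ 2 / 2 - z.1)) := fun z hz => by
    rcases le_or_gt (κ ^ 2 / 2 - z.1) 0 with h | h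
    · rw [expNegInvGlue.zero_of_nonpos h, mul_zero, sub_zero, Real.log_one, mul_zero, add_zero]
      exact one_pos
    · -- `log (1 - cφ) > log φ = -1/A`
      have hφ : expNegInvGlue (κ ^ 2 / 2 - z.1) = Real.exp (-(κ ^ 2 / 2 - z.1)⁻¹) := by
        rw [expNegInvGlue, if_neg (not_le.2 h)]
      have hlt : -(κ ^ 2 / 2 - z.1)⁻¹ < Real.log (1 - pushShift κ z.2 * expNegInvGlue (κ ^ 2 / 2 - z.1)) :=
        (Real.lt_log_iff_exp_lt (hin0 z hz)).2 (by rw [← hφ]; exact key z hz)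
      have := mul_lt_mul_of_pos_left hlt h
      rw [mul_neg, mul_inv_cancel₀ h.ne'] at this
      linarith
  exact contDiffOn_const.sub (hA.contDiffOn.div (contDiffOn_const.add (hA.contDiffOn.mul hlog))
    fun z hz => (hden0 z hz).ne')

end Push

end PushModel

/-- **Registered helper `helper_pushP_conj` (brick (PUSH-b) of T3b (ii), sub-goal of NF6
`stub_steinRealisation`, wave 3, lead c5): the `λ`-push profile of the model push is a smooth
one-parameter family of strictly increasing maps of the `P`-axis, the identity for `P ≥ κ²/2`
and for `q ≥ 1/4`, with the explicit left inverse `pullP`, moving the cone line `P = κ² q` onto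
the swap-slab boundary `P = pFun κ q` of the cocore neighbourhood.** [folklore] -/
theorem helper_pushP_conj : ∀ {κ : ℝ}, 0 < κ → (ContDiff ℝ ∞ fun z : ℝ × ℝ => Summit.SmoothPoincare4.SmoothPoincare4.Theorems.AcyclicBisectionExists.ModpBraidOrbits.PushModel.pushP κ z.1 z.2) ∧ (∀ q : ℝ, StrictMono fun P : ℝ => Summit.SmoothPoincare4.SmoothPoincare4.Theorems.AcyclicBisectionExists.ModpBraidOrbits.PushModel.pushP κ P q) ∧ (∀ P q : ℝ, κ ^ 2 / 2 ≤ P → Summit.SmoothPoincare4.SmoothPoincare4.Theorems.AcyclicBisectionExists.ModpBraidOrbits.PushModel.pushP κ P q = P) ∧ (∀ P q : ℝ, 1 / 4 ≤ q → Summit.SmoothPoincare4.SmoothPoincare4.Theorems.AcyclicBisectionExists.ModpBraidOrbits.PushModel.pushP κ P q = P) ∧ (∀ q : ℝ, Summit.SmoothPoincare4.SmoothPoincare4.Theorems.AcyclicBisectionExists.ModpBraidOrbits.PushModel.pushP κ (κ ^ 2 * q) q = Summit.SmoothPoincare4.SmoothPoincare4.Theorems.AcyclicBisectionExists.ModpBraidOrbits.pFun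 κ q) ∧ (∀ P q : ℝ, Summit.SmoothPoincare4.SmoothPoincare4.Theorems.AcyclicBisectionExists.ModpBraidOrbits.PushModel.pullP κ (Summit.SmoothPoincare4.SmoothPoincare4.Theorems.AcyclicBisectionExists.ModpBraidOrbits.PushModel.pushP κ P q) q = P) := by
  intro κ hκ
  exact ⟨PushModel.contDiff_pushP hκ, PushModel.pushP_strictMono hκ, fun P q h => PushModel.pushP_of_ge q h,
    fun P q h => PushModel.pushP_of_shift_zero P (PushModel.pushShift_of_ge h),
    fun q => PushModel.pushP_base hκ q, fun P q => PushModel.pullP_pushP hκ P q⟩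

end Summit.SmoothPoincare4.SmoothPoincare4.Theorems.AcyclicBisectionExists.ModpBraidOrbits

end
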